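import Mathlib
import Literature.NumberTheory.Automorphic.HilbertPartialHasseWeightShiftingProofs
import Summits.Langlands.Langlands.Theorems.CapacityClassicalityHilbertIntegralOverconvergentIsCongruenceAuxLinearForms
import Summits.Langlands.Langlands.Theorems.CapacityClassicalityHilbertIntegralOverconvergentIsCongruenceStubMvWeightedNormMul
import Summits.Langlands.Langlands.Theorems.CapacityClassicalityHilbertIntegralOverconvergentIsCongruenceStubMvArchBound
import Summits.Langlands.Langlands.Theorems.CapacityClassicalityHilbertIntegralOverconvergentIsCongruenceStubGradedKatzGainW
import Summits.Langlands.Langlands.Theorems.CapacityClassicalityHilbertIntegralOverconvergentIsCongruenceStubKatzDataPolynomialW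
import Summits.Langlands.Langlands.Theorems.CapacityClassicalityHilbertIntegralOverconvergentIsCongruenceStubGainConversionAffine
import Summits.Langlands.Langlands.Theorems.CapacityClassicalityHilbertIntegralOverconvergentIsCongruenceStubMvGainBound

/-!
# Crux `HilbertIntegralOverconvergentIsCongruence` (stmt-Langlands-8485), line `Sketch-ideate-r1-k1`:
# the `d`-FREE ALGEBRAIZATION ENGINE with vector weights (registered stub S7 `stub_abstractEngineMain`)

RESHAPE 5 of the skeleton `Cruxes/HilbertIntegralOverconvergentIsCongruence/Lines/Sketch_ideate_r1_k1.lean`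
(continuation lead c3): the Schneider–Lang assembly of the line in EVERY dimension and for VECTOR weights.
With the conclusion shapes of the registered stubs S2 (`hArch`, archimedean sizes of `f · x^j` in
`MvPowerSeries σ ℂ` for an additive weight), S5 (`hConv`, the arithmetic of the gain for an affine Sturm
line) and S6 (`hGain`, the `p`-adic gain for polynomial expressions in a Katz sum inside a `𝓦`-graded Sturm
family) as hypotheses, the landed stub 16 `stub_auxLinearForms` (Siegel's lemma over `𝓞_E` + the `p`-adic
Liouville inequality) — instantiated with exponents `X = σ →₀ ℕ` weighted by `wt`, unknowns
`β D = Σ_{j<D} I D j`, coefficients `c_D(u, ν) = coeff_ν (f_u · g^{j_u}) ∈ 𝓞_E`, and `η = log R/(4[E:ℚ])` —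
gives `AbstractKatzSturmAlgebraic` (stated unfolded as the conclusion below):

*`E` a number field with `v : E → ℚ̄_p`; `σ` variables with an additive weight `wt` of finite sublevel sets;
`𝓦` an additive group of weights; `V : 𝓦 → Set (ℚ̄_p⟦σ⟧)` a graded family of subspaces closed under
products with the sup-norm Sturm principle on the windows `{wt < L b}`, `L` affine along the rays
`D • w₀ + M • t`; `e ∈ V t` an integral Hasse lift; `g ∈ 𝓞_E⟦σ⟧` whose `v`-image carries a Katz datum
`a_i ∈ V (k + i • t)`, `‖a_i‖ ≤ C ρ^i` (`0 < ρ < 1`), every complex conjugate of `g` having finite weighted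
`ℓ¹` size at every `e^{-η} < 1`; integral families `f_{D,j,i}` (`j < D`) with `v f_{D,j,i} ∈ V (D • w₀ - j • k)`
and sizes `≤ B(η)^D`; the Siegel count `2·#{wt < N₀ D} < Σ_{j<D} #I D j ≤ Q^D` with `m D ≤ N₀ D` for some
`D ≥ 1`, every `m`.  Then some `P ≠ 0` in `𝓞_E` has `Σ_u P_u · f_u · g^{j_u} = 0`.*

Its `σ = Unit`, `𝓦 = ℤ` instance is the landed `d = 1` engine `stub_algebraicMain` (whose proof this file
follows line by line); its `σ = Fin [F:ℚ]`, `𝓦 = ℤ^{Hom(F,ℝ)}` instance is the algebraization half of the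
repaired crux C′.  Theorems only, no `sorry`.
-/

set_option linter.dupNamespace false

noncomputable section

open scoped NumberField

namespace Summit.Langlands.Langlands.Theorems.HilbertIntegralOverconvergentIsCongruence

/-- **The assembly from its parts**: the conclusion shapes of stubs S2 (`hArch`, archimedean sizes), S5
(`hConv`, arithmetic of the gain) and S6 (`hGain`, the `p`-adic gain) imply `AbstractKatzSturmAlgebraic`
(unfolded).  The registered stub `stub_abstractEngineMain` below feeds it the landed parts. [folklore] -/
theorem abstractEngineMain_of_parts
    (hArch : ∀ {σ : Type} (wt : (σ →₀ ℕ) →+ ℕ) (t₀ η : ℝ) (_ : 0 < t₀) (_ : t₀ < 1)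
      (_ : t₀ = Real.exp (-η)) (Bf Bx : ℝ) (_ : 1 ≤ Bx) (f x : MvPowerSeries σ ℂ)
      (_ : Summable fun n : σ →₀ ℕ ↦ ‖MvPowerSeries.coeff n f‖ * t₀ ^ wt n)
      (_ : ∑' n : σ →₀ ℕ, ‖MvPowerSeries.coeff n f‖ * t₀ ^ wt n ≤ Bf)
      (_ : Summable fun n : σ →₀ ℕ ↦ ‖MvPowerSeries.coeff n x‖ * t₀ ^ wt n)
      (_ : ∑' n : σ →₀ ℕ, ‖MvPowerSeries.coeff n x‖ * t₀ ^ wt n ≤ Bx)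
      (j D : ℕ) (_ : j ≤ D) (ν : σ →₀ ℕ),
      ‖MvPowerSeries.coeff ν (f * x ^ j)‖ ≤ Bf * Bx ^ D * Real.exp (η * wt ν))
    (hConv : ∀ (ρ : ℝ) (_ : 0 < ρ) (_ : ρ < 1) (c₀ ct c₁ : ℝ) (_ : 0 < ct),
      ∃ A R : ℝ, 1 ≤ A ∧ 1 < R ∧
        ∀ (D n : ℕ) (x C' : ℝ), 1 ≤ D → 0 ≤ C' → x ≤ C' →
          (∀ M : ℕ, c₀ * D + ct * M + c₁ ≤ n → x ≤ C' * ρ ^ (M + 1)) →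
          x ≤ C' * A ^ D * R⁻¹ ^ n)
    (hGain : ∀ {K σ 𝓦 U : Type} [NormedField K] [IsUltrametricDist K] [AddCommGroup 𝓦] [Fintype U]
      (V : 𝓦 → Set (MvPowerSeries σ K)) (_ : (1 : MvPowerSeries σ K) ∈ V 0)
      (_ : ∀ b : 𝓦, (0 : MvPowerSeries σ K) ∈ V b)
      (_ : ∀ (b : 𝓦) (φ ψ : MvPowerSeries σ K), φ ∈ V b → ψ ∈ V b → φ + ψ ∈ V b)
      (_ : ∀ (b : 𝓦) (c : K) (φ : MvPowerSeries σ K), φ ∈ V b → c • φ ∈ V b)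
      (_ : ∀ (b₁ b₂ : 𝓦) (φ ψ : MvPowerSeries σ K), φ ∈ V b₁ → ψ ∈ V b₂ → φ * ψ ∈ V (b₁ + b₂))
      (wt : (σ →₀ ℕ) →+ ℕ) (L : 𝓦 → ℕ)
      (_ : ∀ b, ∀ T ∈ V b, ∀ B : ℝ, 0 ≤ B →
        (∀ n, wt n < L b → ‖MvPowerSeries.coeff n T‖ ≤ B) → ∀ n, ‖MvPowerSeries.coeff n T‖ ≤ B)
      (e : MvPowerSeries σ K) (t : 𝓦) (_ : MvPowerSeries.constantCoeff e = 1)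
      (_ : ∀ n, ‖MvPowerSeries.coeff n e‖ ≤ 1) (_ : e ∈ V t)
      (G : MvPowerSeries σ K) (k : 𝓦) (a : ℕ → MvPowerSeries σ K) (_ : ∀ i : ℕ, a i ∈ V (k + i • t))
      (ρ C : ℝ) (_ : 0 < ρ) (_ : ρ < 1) (_ : 1 ≤ C) (_ : ∀ i n, ‖MvPowerSeries.coeff n (a i)‖ ≤ C * ρ ^ i)
      (_ : ∀ n, HasSum (fun i : ℕ ↦ MvPowerSeries.coeff n (a i * e⁻¹ ^ i)) (MvPowerSeries.coeff n G))
      (w₀ : 𝓦) (c₀ ct c₁ : ℝ) (_ : ∀ D M : ℕ, (L (D • w₀ + M • t) : ℝ) ≤ c₀ * D + ct * M + c₁)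
      (A R : ℝ)
      (_ : ∀ (D n : ℕ) (x C' : ℝ), 1 ≤ D → 0 ≤ C' → x ≤ C' →
        (∀ M : ℕ, c₀ * D + ct * M + c₁ ≤ n → x ≤ C' * ρ ^ (M + 1)) → x ≤ C' * A ^ D * R⁻¹ ^ n)
      (D : ℕ) (_ : 1 ≤ D) (jU : U → ℕ) (_ : ∀ u, jU u ≤ D)
      (f : U → MvPowerSeries σ K) (_ : ∀ u, f u ∈ V (D • w₀ - jU u • k))
      (_ : ∀ u n, ‖MvPowerSeries.coeff n (f u)‖ ≤ 1) (l : U → K) (_ : ∀ u, ‖l u‖ ≤ 1)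
      (n : ℕ) (_ : ∀ ν, wt ν < n → MvPowerSeries.coeff ν (∑ u, l u • (f u * G ^ jU u)) = 0)
      (ν : σ →₀ ℕ),
      ‖MvPowerSeries.coeff ν (∑ u, l u • (f u * G ^ jU u))‖ ≤ (C * A) ^ D * R⁻¹ ^ n) :
    ∀ (p : ℕ) [Fact p.Prime] (E : Type) [Field E] [NumberField E] (v : E →+* PadicAlgCl p)
      (σ : Type) (wt : (σ →₀ ℕ) →+ ℕ) (_hfin : ∀ n : ℕ, {ν : σ →₀ ℕ | wt ν < n}.Finite)
      (𝓦 : Type) [AddCommGroup 𝓦] (V : 𝓦 → Set (MvPowerSeries σ (PadicAlgCl p)))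
      (_hV1 : (1 : MvPowerSeries σ (PadicAlgCl p)) ∈ V 0)
      (_hV0 : ∀ b, (0 : MvPowerSeries σ (PadicAlgCl p)) ∈ V b)
      (_hVadd : ∀ b φ ψ, φ ∈ V b → ψ ∈ V b → φ + ψ ∈ V b)
      (_hVsmul : ∀ b (c : PadicAlgCl p) φ, φ ∈ V b → c • φ ∈ V b)
      (_hVmul : ∀ b₁ b₂ φ ψ, φ ∈ V b₁ → ψ ∈ V b₂ → φ * ψ ∈ V (b₁ + b₂))
      (L : 𝓦 → ℕ)
      (_hSturm : ∀ b, ∀ T ∈ V b, ∀ B : ℝ, 0 ≤ B →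
        (∀ n, wt n < L b → ‖MvPowerSeries.coeff n T‖ ≤ B) → ∀ n, ‖MvPowerSeries.coeff n T‖ ≤ B)
      (e : MvPowerSeries σ (PadicAlgCl p)) (t : 𝓦) (_he0 : MvPowerSeries.constantCoeff e = 1)
      (_he : ∀ n, ‖MvPowerSeries.coeff n e‖ ≤ 1) (_heV : e ∈ V t)
      (g : MvPowerSeries σ (𝓞 E)) (k : 𝓦)
      (a : ℕ → MvPowerSeries σ (PadicAlgCl p)) (_haV : ∀ i : ℕ, a i ∈ V (k + i • t))
      (ρ C : ℝ) (_hρ0 : 0 < ρ) (_hρ1 : ρ < 1) (_hC : 0 ≤ C)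
      (_ha : ∀ i n, ‖MvPowerSeries.coeff n (a i)‖ ≤ C * ρ ^ i)
      (_hsum : ∀ n, HasSum (fun i : ℕ ↦ MvPowerSeries.coeff n (a i * e⁻¹ ^ i))
        (MvPowerSeries.coeff n (MvPowerSeries.map (v.comp (algebraMap (𝓞 E) E)) g)))
      (w₀ : 𝓦) (c₀ ct c₁ : ℝ) (_hct : 0 < ct)
      (_hL : ∀ D M : ℕ, (L (D • w₀ + M • t) : ℝ) ≤ c₀ * D + ct * M + c₁)
      (I : ℕ → ℕ → Type) [∀ D j, Fintype (I D j)] (f : (D j : ℕ) → I D j → MvPowerSeries σ (𝓞 E))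
      (_hfV : ∀ D j i, j < D →
        MvPowerSeries.map (v.comp (algebraMap (𝓞 E) E)) (f D j i) ∈ V (D • w₀ - j • k))
      (_harch : ∀ η : ℝ, 0 < η → ∃ B : ℝ, 1 ≤ B ∧
        (∀ τ : E →+* ℂ,
          Summable (fun n : σ →₀ ℕ ↦
            ‖τ (algebraMap (𝓞 E) E (MvPowerSeries.coeff n g))‖ * Real.exp (-η) ^ wt n) ∧
          ∑' n : σ →₀ ℕ, ‖τ (algebraMap (𝓞 E) E (MvPowerSeries.coeff n g))‖ * Real.exp (-η) ^ wt n ≤ B) ∧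
        (∀ D j i, j < D → ∀ τ : E →+* ℂ,
          Summable (fun n : σ →₀ ℕ ↦
            ‖τ (algebraMap (𝓞 E) E (MvPowerSeries.coeff n (f D j i)))‖ * Real.exp (-η) ^ wt n) ∧
          ∑' n : σ →₀ ℕ, ‖τ (algebraMap (𝓞 E) E (MvPowerSeries.coeff n (f D j i)))‖ *
            Real.exp (-η) ^ wt n ≤ B ^ D))
      (N₀ : ℕ → ℕ)
      (_hcount : ∀ D, 1 ≤ D →
        2 * {ν : σ →₀ ℕ | wt ν < N₀ D}.ncard < ∑ j ∈ Finset.range D, Fintype.card (I D j))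
      (_hgrowth : ∀ m : ℕ, ∃ D : ℕ, 1 ≤ D ∧ m * D ≤ N₀ D)
      (Q : ℝ) (_hQ : ∀ D, 1 ≤ D → ((∑ j ∈ Finset.range D, Fintype.card (I D j) : ℕ) : ℝ) ≤ Q ^ D),
      ∃ (D : ℕ) (P : ((j : Fin D) × I D j) → 𝓞 E), P ≠ 0 ∧
        ∑ u, (P u) • (f D u.1 u.2 * g ^ (u.1 : ℕ)) = 0 := by
  intro p _ E _ _ v σ wt hfin 𝓦 _ V hV1 hV0 hVadd hVsmul hVmul L hSturm e t he0 he heV g k a haV ρ C hρ0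
    hρ1 hC ha hsum w₀ c₀ ct c₁ hct hL I _ f hfV harch N₀ hcount hgrowth Q hQ
  classical
  /- ### 1. Constants -/
  obtain ⟨A₅, R, hA₅, hR, hconv⟩ := hConv ρ hρ0 hρ1 c₀ ct c₁ hct
  have hR0 : 0 < R := zero_lt_one.trans hR
  have hC'1 : (1 : ℝ) ≤ max 1 C := le_max_left _ _
  have hA'1 : (1 : ℝ) ≤ max 1 C * A₅ := one_le_mul_of_one_le_of_one_le hC'1 hA₅
  have hdE : 1 ≤ Module.finrank ℚ E := Module.finrank_pos
  obtain ⟨η, hη_def⟩ : ∃ η : ℝ, η = Real.log R / (4 * (Module.finrank ℚ E)) := ⟨_, rfl⟩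
  have hlogR : 0 < Real.log R := Real.log_pos hR
  have hη0 : 0 < η := by rw [hη_def]; positivity
  have hexpR : Real.exp (2 * η * (Module.finrank ℚ E)) < R := by
    have h2 : 2 * η * (Module.finrank ℚ E) = Real.log R / 2 := by
      rw [hη_def]; field_simp; ring
    rw [h2]
    calc Real.exp (Real.log R / 2) < Real.exp (Real.log R) := Real.exp_lt_exp.mpr (by linarith)
      _ = R := Real.exp_log hR0
  obtain ⟨t₀, ht₀_def⟩ : ∃ t₀ : ℝ, t₀ = Real.exp (-η) := ⟨_, rfl⟩
  have ht₀0 : 0 < t₀ := by rw [ht₀_def]; exact Real.exp_pos _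
  have ht₀1 : t₀ < 1 := by rw [ht₀_def, Real.exp_lt_one_iff]; linarith
  /- ### 2. Archimedean sizes at `t₀` -/
  obtain ⟨B, hB1, hBg, hBf⟩ := harch η hη0
  have hBB1 : (1 : ℝ) ≤ B * B := one_le_mul_of_one_le_of_one_le hB1 hB1
  /- ### 3. The unknowns `β D = Σ_{j < D} I D j` -/
  let β : ℕ → Type := fun D ↦ (jj : Fin D) × I D jj
  have hβcard : ∀ D, Fintype.card (β D) = ∑ jj ∈ Finset.range D, Fintype.card (I D jj) := by
    intro D
    change Fintype.card ((jj : Fin D) × I D jj) = _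
    rw [Fintype.card_sigma]
    exact Fin.sum_univ_eq_sum_range (fun jj ↦ Fintype.card (I D jj)) D
  have hfin' : ∀ D, {ν : σ →₀ ℕ | (wt : (σ →₀ ℕ) → ℕ) ν < N₀ D}.Finite := fun D ↦ hfin (N₀ D)
  have hcount' : ∀ D, 1 ≤ D →
      2 * {ν : σ →₀ ℕ | (wt : (σ →₀ ℕ) → ℕ) ν < N₀ D}.ncard < Fintype.card (β D) := by
    intro D hD
    rw [hβcard]
    exact hcount D hD
  have hQ' : ∀ D, 1 ≤ D → (Fintype.card (β D) : ℝ) ≤ Q ^ D := by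
    intro D hD
    rw [hβcard]
    exact hQ D hD
  /- ### 4. The coefficients `c_D(u, ν) = coeff_ν (f_u · g^{j_u}) ∈ 𝓞_E` -/
  let FO : (D : ℕ) → β D → MvPowerSeries σ (𝓞 E) := fun D uu ↦ f D uu.1 uu.2 * g ^ (uu.1 : ℕ)
  let cc : (D : ℕ) → β D → (σ →₀ ℕ) → E := fun D uu ν ↦
    algebraMap (𝓞 E) E (MvPowerSeries.coeff ν (FO D uu))
  have hint' : ∀ D uu ν, IsIntegral ℤ (cc D uu ν) := fun D uu ν ↦
    NumberField.RingOfIntegers.isIntegral_coe _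
  have hFOmap : ∀ {S : Type} [CommRing S] (φ : 𝓞 E →+* S) (D : ℕ) (uu : β D),
      MvPowerSeries.map φ (FO D uu) =
        MvPowerSeries.map φ (f D uu.1 uu.2) * (MvPowerSeries.map φ g) ^ (uu.1 : ℕ) := by
    intro S _ φ D uu
    change MvPowerSeries.map φ (f D uu.1 uu.2 * g ^ (uu.1 : ℕ)) = _
    rw [map_mul, map_pow]
  have hlin : ∀ (D : ℕ) (P : β D → 𝓞 E) (ν : σ →₀ ℕ),
      ∑ uu, (P uu : E) * cc D uu ν =
        algebraMap (𝓞 E) E (MvPowerSeries.coeff ν (∑ uu, P uu • FO D uu)) := by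
    intro D P ν
    rw [map_sum, map_sum]
    refine Finset.sum_congr rfl fun uu _ ↦ ?_
    rw [MvPowerSeries.coeff_smul, map_mul]
  have hlin_map : ∀ {S : Type} [CommRing S] (φ : 𝓞 E →+* S) (D : ℕ) (P : β D → 𝓞 E) (ν : σ →₀ ℕ),
      φ (MvPowerSeries.coeff ν (∑ uu, P uu • FO D uu)) =
        MvPowerSeries.coeff ν (∑ uu, φ (P uu) •
          (MvPowerSeries.map φ (f D uu.1 uu.2) * (MvPowerSeries.map φ g) ^ (uu.1 : ℕ))) := by
    intro S _ φ D P ν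
    rw [← MvPowerSeries.coeff_map, map_sum]
    congr 1
    refine Finset.sum_congr rfl fun uu _ ↦ ?_
    rw [MvPowerSeries.smul_eq_C_mul, map_mul, MvPowerSeries.map_C, hFOmap, MvPowerSeries.smul_eq_C_mul]
  /- ### 5. The archimedean bounds (S2) -/
  have harch' : ∀ (D : ℕ) (uu : β D) (ν : σ →₀ ℕ) (τ : E →+* ℂ),
      ‖τ (cc D uu ν)‖ ≤ (B * B) ^ D * Real.exp (η * ((wt : (σ →₀ ℕ) → ℕ) ν : ℕ)) := by
    intro D uu ν τ
    have hjjD : (uu.1 : ℕ) < D := Fin.is_lt uu.1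
    set τ' : 𝓞 E →+* ℂ := τ.comp (algebraMap (𝓞 E) E) with hτ'_def
    have hτcc : τ (cc D uu ν) = MvPowerSeries.coeff ν
        (MvPowerSeries.map τ' (f D uu.1 uu.2) * (MvPowerSeries.map τ' g) ^ (uu.1 : ℕ)) := by
      rw [← hFOmap, MvPowerSeries.coeff_map]
      rfl
    have hSf : Summable fun n : σ →₀ ℕ ↦
        ‖MvPowerSeries.coeff n (MvPowerSeries.map τ' (f D uu.1 uu.2))‖ * t₀ ^ wt n := by
      refine ((hBf D uu.1 uu.2 hjjD τ).1).congr fun n ↦ ?_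
      rw [MvPowerSeries.coeff_map, ht₀_def]
      rfl
    have hWf : ∑' n : σ →₀ ℕ,
        ‖MvPowerSeries.coeff n (MvPowerSeries.map τ' (f D uu.1 uu.2))‖ * t₀ ^ wt n ≤ B ^ D := by
      have h := (hBf D uu.1 uu.2 hjjD τ).2
      rw [ht₀_def]
      refine le_of_eq_of_le (tsum_congr fun n ↦ ?_) h
      rw [MvPowerSeries.coeff_map]
      rfl
    have hSg : Summable fun n : σ →₀ ℕ ↦
        ‖MvPowerSeries.coeff n (MvPowerSeries.map τ' g)‖ * t₀ ^ wt n := by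
      refine ((hBg τ).1).congr fun n ↦ ?_
      rw [MvPowerSeries.coeff_map, ht₀_def]
      rfl
    have hWg : ∑' n : σ →₀ ℕ, ‖MvPowerSeries.coeff n (MvPowerSeries.map τ' g)‖ * t₀ ^ wt n ≤ B := by
      have h := (hBg τ).2
      rw [ht₀_def]
      refine le_of_eq_of_le (tsum_congr fun n ↦ ?_) h
      rw [MvPowerSeries.coeff_map]
      rfl
    rw [hτcc, mul_pow]
    exact hArch wt t₀ η ht₀0 ht₀1 ht₀_def (B ^ D) B hB1 _ _ hSf hWf hSg hWg (uu.1 : ℕ) D hjjD.le ν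
  /- ### 6. The gain (S6) -/
  set v' : 𝓞 E →+* PadicAlgCl p := v.comp (algebraMap (𝓞 E) E) with hv'_def
  have hv'int : ∀ x : 𝓞 E, ‖v' x‖ ≤ 1 := fun x ↦
    Literature.NumberTheory.Automorphic.PadicAlgCl.norm_le_one_of_isIntegral p
      ((NumberField.RingOfIntegers.isIntegral_coe x).map v.toIntAlgHom)
  have ha' : ∀ i n, ‖MvPowerSeries.coeff n (a i)‖ ≤ max 1 C * ρ ^ i := fun i n ↦
    (ha i n).trans (mul_le_mul_of_nonneg_right (le_max_right 1 C) (pow_nonneg hρ0.le i))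
  have hgain' : ∀ (D : ℕ) (P : β D → 𝓞 E) (n : ℕ),
      (∀ ν, (wt : (σ →₀ ℕ) → ℕ) ν < n → ∑ uu, (P uu : E) * cc D uu ν = 0) →
      ∀ ν, ‖v (∑ uu, (P uu : E) * cc D uu ν)‖ ≤ (max 1 C * A₅) ^ D * R⁻¹ ^ n := by
    intro D P n hvan ν
    rcases Nat.eq_zero_or_pos D with hD0 | hDpos
    · subst hD0
      haveI : IsEmpty (β 0) := by
        change IsEmpty ((jj : Fin 0) × I 0 jj); infer_instance
      rw [Fintype.sum_empty, map_zero, norm_zero]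
      exact mul_nonneg (pow_nonneg (zero_le_one.trans hA'1) _) (pow_nonneg (inv_nonneg.mpr hR0.le) _)
    obtain ⟨FPK, hFPK_def⟩ : ∃ FPK : MvPowerSeries σ (PadicAlgCl p),
        FPK = ∑ uu : β D, v' (P uu) •
          (MvPowerSeries.map v' (f D uu.1 uu.2) * (MvPowerSeries.map v' g) ^ (uu.1 : ℕ)) := ⟨_, rfl⟩
    have hvS : ∀ ν' : σ →₀ ℕ, v (∑ uu, (P uu : E) * cc D uu ν') = MvPowerSeries.coeff ν' FPK := by
      intro ν'
      rw [hlin, show v (algebraMap (𝓞 E) E _) = v' _ from rfl, hlin_map v' D P ν', hFPK_def]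
    have hvan' : ∀ ν', wt ν' < n → MvPowerSeries.coeff ν' FPK = 0 := fun ν' hν' ↦ by
      rw [← hvS, hvan ν' hν', map_zero]
    rw [hvS, hFPK_def]
    rw [hFPK_def] at hvan'
    exact hGain (K := PadicAlgCl p) (σ := σ) (𝓦 := 𝓦) (U := β D) V hV1 hV0 hVadd hVsmul hVmul wt L hSturm
      e t he0 he heV (MvPowerSeries.map v' g) k a haV ρ (max 1 C) hρ0 hρ1 hC'1 ha' hsum w₀ c₀ ct c₁ hL
      A₅ R hconv D hDpos (fun uu ↦ (uu.1 : ℕ)) (fun uu ↦ (Fin.is_lt uu.1).le)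
      (fun uu ↦ MvPowerSeries.map v' (f D uu.1 uu.2)) (fun uu ↦ hfV D uu.1 uu.2 (Fin.is_lt uu.1))
      (fun uu m ↦ by rw [MvPowerSeries.coeff_map]; exact hv'int _) (fun uu ↦ v' (P uu))
      (fun uu ↦ hv'int _) n hvan' ν
  /- ### 7. Siegel + Liouville (stub 16) and the conclusion -/
  obtain ⟨D, P, hP0, hrel⟩ := stub_auxLinearForms E p v (σ →₀ ℕ) wt β N₀ hfin' hcount' hgrowth Q hQ' cc
    hint' (B * B) η hBB1 hη0.le harch' (max 1 C * A₅) R hA'1 hexpR hgain'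
  refine ⟨D, P, hP0, ?_⟩
  refine MvPowerSeries.ext fun ν ↦ ?_
  rw [map_zero]
  have h := hrel ν
  rw [hlin] at h
  exact NumberField.RingOfIntegers.coe_injective (h.trans (map_zero _).symm)

/-- **Registered stub S7 (`stub_abstractEngineMain`) of line `Sketch-ideate-r1-k1`: the `d`-FREE
VECTOR-WEIGHT ALGEBRAIZATION ENGINE `AbstractKatzSturmAlgebraic` (unfolded), hypothesis-free** — the assembly
`abstractEngineMain_of_parts` fed with the landed stubs S1 (`stub_mvWeightedNormMul`), S2 (`stub_mvArchBound`),
S3 (`stub_gradedKatzGainW`), S4 (`stub_katzDataPolynomialW`), S5 (`stub_gainConversionAffine`), S6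
(`stub_mvGainBound`) and stub 16 (`stub_auxLinearForms`). [folklore] -/
theorem stub_abstractEngineMain :
    ∀ (p : ℕ) [Fact p.Prime] (E : Type) [Field E] [NumberField E] (v : E →+* PadicAlgCl p)
      (σ : Type) (wt : (σ →₀ ℕ) →+ ℕ) (_hfin : ∀ n : ℕ, {ν : σ →₀ ℕ | wt ν < n}.Finite)
      (𝓦 : Type) [AddCommGroup 𝓦] (V : 𝓦 → Set (MvPowerSeries σ (PadicAlgCl p)))
      (_hV1 : (1 : MvPowerSeries σ (PadicAlgCl p)) ∈ V 0)
      (_hV0 : ∀ b, (0 : MvPowerSeries σ (PadicAlgCl p)) ∈ V b)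
      (_hVadd : ∀ b φ ψ, φ ∈ V b → ψ ∈ V b → φ + ψ ∈ V b)
      (_hVsmul : ∀ b (c : PadicAlgCl p) φ, φ ∈ V b → c • φ ∈ V b)
      (_hVmul : ∀ b₁ b₂ φ ψ, φ ∈ V b₁ → ψ ∈ V b₂ → φ * ψ ∈ V (b₁ + b₂))
      (L : 𝓦 → ℕ)
      (_hSturm : ∀ b, ∀ T ∈ V b, ∀ B : ℝ, 0 ≤ B →
        (∀ n, wt n < L b → ‖MvPowerSeries.coeff n T‖ ≤ B) → ∀ n, ‖MvPowerSeries.coeff n T‖ ≤ B)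
      (e : MvPowerSeries σ (PadicAlgCl p)) (t : 𝓦) (_he0 : MvPowerSeries.constantCoeff e = 1)
      (_he : ∀ n, ‖MvPowerSeries.coeff n e‖ ≤ 1) (_heV : e ∈ V t)
      (g : MvPowerSeries σ (𝓞 E)) (k : 𝓦)
      (a : ℕ → MvPowerSeries σ (PadicAlgCl p)) (_haV : ∀ i : ℕ, a i ∈ V (k + i • t))
      (ρ C : ℝ) (_hρ0 : 0 < ρ) (_hρ1 : ρ < 1) (_hC : 0 ≤ C)
      (_ha : ∀ i n, ‖MvPowerSeries.coeff n (a i)‖ ≤ C * ρ ^ i)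
      (_hsum : ∀ n, HasSum (fun i : ℕ ↦ MvPowerSeries.coeff n (a i * e⁻¹ ^ i))
        (MvPowerSeries.coeff n (MvPowerSeries.map (v.comp (algebraMap (𝓞 E) E)) g)))
      (w₀ : 𝓦) (c₀ ct c₁ : ℝ) (_hct : 0 < ct)
      (_hL : ∀ D M : ℕ, (L (D • w₀ + M • t) : ℝ) ≤ c₀ * D + ct * M + c₁)
      (I : ℕ → ℕ → Type) [∀ D j, Fintype (I D j)] (f : (D j : ℕ) → I D j → MvPowerSeries σ (𝓞 E))
      (_hfV : ∀ D j i, j < D →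
        MvPowerSeries.map (v.comp (algebraMap (𝓞 E) E)) (f D j i) ∈ V (D • w₀ - j • k))
      (_harch : ∀ η : ℝ, 0 < η → ∃ B : ℝ, 1 ≤ B ∧
        (∀ τ : E →+* ℂ,
          Summable (fun n : σ →₀ ℕ ↦
            ‖τ (algebraMap (𝓞 E) E (MvPowerSeries.coeff n g))‖ * Real.exp (-η) ^ wt n) ∧
          ∑' n : σ →₀ ℕ, ‖τ (algebraMap (𝓞 E) E (MvPowerSeries.coeff n g))‖ * Real.exp (-η) ^ wt n ≤ B) ∧
        (∀ D j i, j < D → ∀ τ : E →+* ℂ,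
          Summable (fun n : σ →₀ ℕ ↦
            ‖τ (algebraMap (𝓞 E) E (MvPowerSeries.coeff n (f D j i)))‖ * Real.exp (-η) ^ wt n) ∧
          ∑' n : σ →₀ ℕ, ‖τ (algebraMap (𝓞 E) E (MvPowerSeries.coeff n (f D j i)))‖ *
            Real.exp (-η) ^ wt n ≤ B ^ D))
      (N₀ : ℕ → ℕ)
      (_hcount : ∀ D, 1 ≤ D →
        2 * {ν : σ →₀ ℕ | wt ν < N₀ D}.ncard < ∑ j ∈ Finset.range D, Fintype.card (I D j))
      (_hgrowth : ∀ m : ℕ, ∃ D : ℕ, 1 ≤ D ∧ m * D ≤ N₀ D)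
      (Q : ℝ) (_hQ : ∀ D, 1 ≤ D → ((∑ j ∈ Finset.range D, Fintype.card (I D j) : ℕ) : ℝ) ≤ Q ^ D),
      ∃ (D : ℕ) (P : ((j : Fin D) × I D j) → 𝓞 E), P ≠ 0 ∧
        ∑ u, (P u) • (f D u.1 u.2 * g ^ (u.1 : ℕ)) = 0 :=
  abstractEngineMain_of_parts (fun {σ} wt ↦ @stub_mvArchBound σ wt (@stub_mvWeightedNormMul σ wt))
    stub_gainConversionAffine
    (fun {K σ 𝓦 U} _ _ _ _ V hV1 hV0 hVadd hVsmul hVmul ↦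
      @stub_mvGainBound K σ 𝓦 U _ _ _ _ (fun {U'} _ ↦ @stub_katzDataPolynomialW K σ 𝓦 U' _ _ _ _)
        (@stub_gradedKatzGainW K σ 𝓦 _ _ _) V hV1 hV0 hVadd hVsmul hVmul)

end Summit.Langlands.Langlands.Theorems.HilbertIntegralOverconvergentIsCongruence

end
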